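import Literature.AlgebraicGeometry.Motives.MonomialSupportedHypersurfaceFamily
import Literature.AlgebraicGeometry.Motives.HypersurfaceChartAlgebra
import Literature.AlgebraicGeometry.Motives.ProjBasicOpenSubscheme
import Literature.AlgebraicGeometry.HodgeTheory.SpreadingOutQbarFamilyProofs
import HarnessLib

/-!
# The incidence variety of a base-point-free monomial linear system is smooth

Family `hodge`, layer `Literature/AlgebraicGeometry/Motives`. For a field `k`, `n d : ℕ` and a set
`M ⊆ DegIndex n d` of exponents of degree-`d` monomials in `x₀, …, x_{n+1}` (as in
`Motives/MonomialSupportedHypersurfaceFamily`: coefficient ring `R_M = k[a_m | m ∈ M]` of the affine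
space `𝔸^M` of `M`-supported forms), this file constructs

* `universalFormM = F_M = Σ_{m ∈ M} a_m x^m ∈ R_M[x₀, …, x_{n+1}]`, the universal `M`-supported form;
* **the incidence variety** `incidenceM = W_M = V₊(F_M) ⊆ ℙⁿ⁺¹_{R_M} = 𝔸^M × ℙⁿ⁺¹` — the universal
  hypersurface over the WHOLE affine space of `M`-supported forms, singular members included
  (reduced induced closed subscheme structure, exactly as `UniversalHypersurface.totalSpace` for the
  full system), with `incidenceToSpecM : W_M → 𝔸^M` and the `k`-scheme `incidenceOverM`.

and proves, when the system is **base-point free**, i.e. `xᵢ^d ∈ M` for every `i`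
(`IsBasePointFree`):

* `elimEquiv` — on the chart `D₊(xᵢ)` the dehomogenised equation `f_i = a_{d eᵢ} + Σ' a_m y^m` is
  LINEAR in the coefficient `a_{d eᵢ}` with coefficient `1`, so
  `R_M[y₀, …, yₙ]/(f_i) ≅ k[a_m (m ≠ d eᵢ), y₀, …, yₙ]` is a polynomial ring (elimination of one
  variable); hence the chart is an affine space `𝔸^{|M| + n}`;
* `ideal_coordChartOpenM_eq`, `chartSectionsQuotEquivElimM` — the reduced induced ideal of `V₊(F_M)`
  over `D₊(xᵢ)` is `(F_M/xᵢᵈ)` itself, and `Γ(D₊(xᵢ))/𝓘 ≅ k[a_m (m ≠ d eᵢ), y₀, …, yₙ]`;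
* `smoothOfRelativeDimension_incidenceOverM_hom` — **`W_M` is smooth over `k` of relative dimension
  `|M| + n`** (`W_M → ℙⁿ⁺¹` is a bundle of hyperplanes of `𝔸^M`; the `D₊(xᵢ)` cover the total space);
* `isQuasiProjectiveOver_incidenceOverM`, `irreducibleSpace_incidenceM` — `W_M` is quasi-projective
  and irreducible (union of the pairwise-meeting irreducible affine charts; the common point
  `(a = 0, x = (1 : ⋯ : 1))` is `diagPointM`).

These are exactly the hypotheses of the tree's theorem
`HodgeTheory.Hironaka1964_smoothCompactification_holds`, so that `W_M` — which contains the total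
space of the smooth `M`-supported family `familyM` as the open subscheme over the nonsingular forms —
has a smooth projective compactification; this is the geometric input of the global invariant cycle
theorem (Deligne, Hodge II 4.1.1; Voisin II Thm. 4.24, proof: "it suffices then to apply proposition
4.23 to the inclusions `X_t ⊂ X_U ⊂ X`" for ANY smooth projective `X ⊇ X_U`) for the monomially
supported families of route `SignSymmetricPowers` of the Hodge conjecture (crux K1-B, piece FIB:
"no monodromy invariants on `H³`"), where the fibre inclusion `X_t ↪ W_M` is homotopic, through the
scaling `(a, x) ↦ (s a, x)`, to a map through the zero section `ℙⁿ⁺¹ ≅ {a = 0} ⊆ W_M`.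

Everything is proved; no named fact is introduced.

## References

* C. Voisin, *Hodge Theory and Complex Algebraic Geometry II* (2003), §2.1.1 eq. (2.2) ("the first
  projection `Z → X` makes `Z` into a projective bundle"), §6.2.1, Thm. 4.24 and its proof (p. 124).
  [VoisinHodgeII2003]
* R. Hartshorne, *Algebraic Geometry* (1977): II Prop. 2.5, II Example 3.2.6, III §10 (Thm. 10.2,
  Example 10.0.1). [Hartshorne1977]
-/

noncomputable section

open CategoryTheory AlgebraicGeometry MvPolynomial HomogeneousLocalization TopologicalSpace Limits
-- `M : Set (DegIndex n d)` is summed over as a finite type (classical decidability of membership).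
open scoped Classical

universe u

namespace Literature.AlgebraicGeometry.Motives.UniversalHypersurface

/-! ### The universal `M`-supported form `F_M = Σ_{m ∈ M} a_m x^m` -/

section Form

variable (k : Type u) [Field k] (n d : ℕ) (M : Set (DegIndex n d))

/-- **The universal `M`-supported form** `F_M = Σ_{m ∈ M} a_m x^m ∈ R_M[x₀, …, x_{n+1}]`
(`R_M = k[a_m | m ∈ M]`), the restriction of the universal form of degree `d` to the linear subsystem
spanned by the monomials of `M` (Voisin II, §6.2.1). [cite: VoisinHodgeII2003, §6.2.1] -/
def universalFormM : MvPolynomial (Fin (n + 2)) (CoeffRingM k n d M) :=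
  ∑ m : M, monomial m.1.1 (X m)

/-- `F_M` is homogeneous of degree `d`. [cite: VoisinHodgeII2003, §6.2.1] -/
theorem isHomogeneous_universalFormM : (universalFormM k n d M).IsHomogeneous d :=
  IsHomogeneous.sum _ _ _ fun m _ => isHomogeneous_monomial (X m) m.1.2

/-- `F_M` lies in the degree-`d` piece of the grading of `R_M[x]`. [cite: VoisinHodgeII2003, §6.2.1] -/
theorem universalFormM_mem :
    universalFormM k n d M ∈ MvPolynomial.homogeneousSubmodule (Fin (n + 2)) (CoeffRingM k n d M) d :=
  (mem_homogeneousSubmodule d _).mpr (isHomogeneous_universalFormM k n d M)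

/-- **Base-point freeness of the monomial system**: every pure power `xᵢ^d` belongs to `M` (then the
monomials of `M` have no common zero on `ℙⁿ⁺¹`; conversely a missing `xᵢ^d` makes the coordinate
point `eᵢ` a base point). For the `ι`-even monomials of an even degree `d` this holds.
[cite: VoisinHodgeII2003, §6.2.1] -/
def IsBasePointFree (M' : Set (DegIndex n d)) : Prop :=
  ∀ i : Fin (n + 2), ⟨Finsupp.single i d, by simp [Finsupp.degree_single]⟩ ∈ M'

/-- The exponent `d • eᵢ` of the pure power `xᵢ^d`, as an element of `M` under base-point freeness.
[cite: VoisinHodgeII2003, §6.2.1] -/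
def purePower (hM : IsBasePointFree n d M) (i : Fin (n + 2)) : M :=
  ⟨⟨Finsupp.single i d, by simp [Finsupp.degree_single]⟩, hM i⟩

/-- Unfolding `purePower` (`rfl`). [cite: VoisinHodgeII2003, §6.2.1] -/
@[simp]
theorem purePower_val (hM : IsBasePointFree n d M) (i : Fin (n + 2)) :
    ((purePower n d M hM i : M) : DegIndex n d).1 = Finsupp.single i d :=
  rfl

end Form

/-! ### The incidence variety `W_M = V₊(F_M) ⊆ ℙⁿ⁺¹_{R_M} = 𝔸^M × ℙⁿ⁺¹` -/

section Incidence

variable (k : Type u) [Field k] (n d : ℕ) (M : Set (DegIndex n d))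

attribute [local instance] MvPolynomial.gradedAlgebra ProjBaseChange.algebraBase
  ProjBaseChange.isScalarTower_localization

/-- graded pieces of `R[x₀, …, x_{n+1}]` -/
local notation "𝒜" R => MvPolynomial.homogeneousSubmodule (Fin (n + 2)) R

/-- The closed subset `V₊(F_M) ⊆ ℙⁿ⁺¹_{R_M}`. [cite: VoisinHodgeII2003, §6.2.1] -/
def zeroLocusClosedM : Closeds (projSp n (CoeffRingM k n d M)) :=
  ⟨ProjectiveSpectrum.zeroLocus (𝒜 (CoeffRingM k n d M)) {universalFormM k n d M},
    ProjectiveSpectrum.isClosed_zeroLocus _ _⟩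

/-- The ideal sheaf of the reduced induced structure on `V₊(F_M)` (Mathlib
`IdealSheafData.vanishingIdeal`; Hartshorne II Example 3.2.6). [cite: Hartshorne1977, II Example 3.2.6] -/
def idealSheafM : (projSp n (CoeffRingM k n d M)).IdealSheafData :=
  Scheme.IdealSheafData.vanishingIdeal (zeroLocusClosedM k n d M)

/-- **The incidence variety `W_M = {(a, x) | Σ_{m ∈ M} a_m x^m = 0} ⊆ 𝔸^M × ℙⁿ⁺¹`** of the monomial
linear system `M`: the universal hypersurface over the whole affine space of `M`-supported forms
(singular members included), a reduced closed subscheme of `ℙⁿ⁺¹_{R_M}`.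
[cite: VoisinHodgeII2003, §6.2.1] -/
abbrev incidenceM : Scheme.{u} := (idealSheafM k n d M).subscheme

/-- The closed immersion `W_M ↪ ℙⁿ⁺¹_{R_M}`. [cite: VoisinHodgeII2003, §6.2.1] -/
abbrev incidenceιM : incidenceM k n d M ⟶ projSp n (CoeffRingM k n d M) :=
  (idealSheafM k n d M).subschemeι

/-- The projection `W_M → 𝔸^M = Spec R_M` to the space of `M`-supported forms.
[cite: VoisinHodgeII2003, §6.2.1] -/
abbrev incidenceToSpecM : incidenceM k n d M ⟶ Spec (.of (CoeffRingM k n d M)) :=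
  incidenceιM k n d M ≫ projSpToSpec n (CoeffRingM k n d M)

/-- `ℙⁿ⁺¹_{R_M} → Spec R_M` is proper (Hartshorne II Thm. 4.9). [cite: Hartshorne1977, II Thm. 4.9] -/
instance isProper_projSpToSpecM : IsProper (projSpToSpec n (CoeffRingM k n d M)) :=
  ProjBaseChangeRing.isProper_projToSpec (Fin (n + 2)) _

/-- `W_M → 𝔸^M` is proper. [cite: Hartshorne1977, II Thm. 4.9] -/
instance isProper_incidenceToSpecM : IsProper (incidenceToSpecM k n d M) := inferInstance

/-- The incidence variety as a `k`-scheme, `W_M → 𝔸^M → Spec k`. [cite: VoisinHodgeII2003, §6.2.1] -/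
def incidenceOverM : SchemeOver k :=
  Over.mk (incidenceToSpecM k n d M ≫ specMToSpec k n d M)

/-- The structure morphism of `incidenceOverM` (`rfl`). [cite: VoisinHodgeII2003, §6.2.1] -/
theorem incidenceOverM_hom :
    (incidenceOverM k n d M).hom = incidenceToSpecM k n d M ≫ specMToSpec k n d M :=
  rfl

/-- The support of the ideal sheaf of `W_M` is `V₊(F_M)`. [cite: Hartshorne1977, II Example 3.2.6] -/
theorem coe_support_idealSheafM :
    ((idealSheafM k n d M).support : Set (projSp n (CoeffRingM k n d M))) =
      ProjectiveSpectrum.zeroLocus (𝒜 (CoeffRingM k n d M)) {universalFormM k n d M} := by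
  rw [idealSheafM, Scheme.IdealSheafData.coe_support_vanishingIdeal]
  rfl

/-- The image of `W_M ↪ ℙⁿ⁺¹_{R_M}` is `V₊(F_M)`. [cite: Hartshorne1977, II Example 3.2.6] -/
theorem range_incidenceιM :
    Set.range (incidenceιM k n d M) =
      ProjectiveSpectrum.zeroLocus (𝒜 (CoeffRingM k n d M)) {universalFormM k n d M} := by
  rw [Scheme.IdealSheafData.range_subschemeι, coe_support_idealSheafM]

/-- `W_M` is quasi-projective over `k`: a closed subscheme of `ℙⁿ⁺¹ × 𝔸^M`, proper over the finite
type affine `k`-scheme `𝔸^M` (the tree's `isQuasiProjectiveOver_of_proj_over_specOver`,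
Hartshorne II §4). [cite: Hartshorne1977, Ch. II §4 (p. 103) and Ex. 4.9] -/
theorem isQuasiProjectiveOver_incidenceOverM :
    HodgeTheory.IsQuasiProjectiveOver (incidenceOverM k n d M) :=
  HodgeTheory.SpreadingOutQbar.isQuasiProjectiveOver_of_proj_over_specOver (k := k) (CoeffRingM k n d M)
    (incidenceToSpecM k n d M) (incidenceιM k n d M) rfl

end Incidence

/-! ### Elimination of the coefficient `a_{d eᵢ}` on the chart `D₊(xᵢ)` -/

section Elimination

variable (k : Type u) [Field k] (n d : ℕ) (M : Set (DegIndex n d)) (hM : IsBasePointFree n d M)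
  (i : Fin (n + 2))

/-- The dehomogenised universal `M`-form on the chart `D₊(xᵢ)`:
`f_i = F_M(xᵢ := 1) ∈ R_M[y₀, …, yₙ]` (`ProjectiveSpace.dehomogenize`). [cite: Hartshorne1977, II Prop. 2.5] -/
def chartFormM : MvPolynomial (Fin (n + 1)) (CoeffRingM k n d M) :=
  ProjectiveSpace.dehomogenize (CoeffRingM k n d M) i (universalFormM k n d M)

/-- The dehomogenised monomial `x^m (xᵢ := 1)` evaluated at a vector `v` of "affine coordinates"
(`vⱼ` in the slot `x_{i.succAbove j}`, `1` in the slot `xᵢ`): `Πⱼ (insertNth i 1 v)ⱼ ^ mⱼ`, in any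
commutative `k`-algebra. [cite: Hartshorne1977, II Prop. 2.5] -/
def dehomMonomialAt {B : Type*} [CommSemiring B] (v : Fin (n + 1) → B) (m : Fin (n + 2) →₀ ℕ) : B :=
  m.prod fun j e => (Fin.insertNth (α := fun _ => B) i 1 v j) ^ e

/-- At the pure power `xᵢ^d` the dehomogenised monomial is `1`. [cite: Hartshorne1977, II Prop. 2.5] -/
theorem dehomMonomialAt_single_self {B : Type*} [CommSemiring B] (v : Fin (n + 1) → B) :
    dehomMonomialAt n i v (Finsupp.single i d) = 1 := by
  rw [dehomMonomialAt, Finsupp.prod_single_index] <;> simp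

/-- `f_i = Σ_{m ∈ M} a_m · x^m(xᵢ := 1)` with the dehomogenised monomials read in `R_M[y]`
(Mathlib `aeval_monomial`). [cite: Hartshorne1977, II Prop. 2.5] -/
theorem chartFormM_eq :
    chartFormM k n d M i = ∑ m : M, C (X m) * dehomMonomialAt n i X m.1.1 := by
  rw [chartFormM, universalFormM, map_sum]
  refine Finset.sum_congr rfl fun m _ => ?_
  rw [ProjectiveSpace.dehomogenize, aeval_monomial, dehomMonomialAt]
  rfl

/-- The index type of the variables surviving the elimination: the coefficients `a_m`, `m ≠ d eᵢ`,
and the affine coordinates `y₀, …, yₙ`. [cite: Hartshorne1977, II Prop. 2.5] -/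
abbrev ElimVars : Type := {m : M // m ≠ purePower n d M hM i} ⊕ Fin (n + 1)

/-- The target polynomial ring `B = k[a_m (m ≠ d eᵢ), y₀, …, yₙ]` of the elimination.
[cite: Hartshorne1977, II Prop. 2.5] -/
abbrev ElimRing : Type u := MvPolynomial (ElimVars n d M hM i) k

/-- The dehomogenised monomials read in `B` (affine coordinates `yⱼ ↦ X (inr j)`).
[cite: Hartshorne1977, II Prop. 2.5] -/
abbrev elimMonomial (m : Fin (n + 2) →₀ ℕ) : ElimRing k n d M hM i :=
  dehomMonomialAt n i (fun j => X (Sum.inr j)) m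

/-- The value substituted for the eliminated coefficient:
`a_{d eᵢ} ↦ -Σ_{m ≠ d eᵢ} a_m · x^m(xᵢ := 1)`. [cite: Hartshorne1977, II Prop. 2.5] -/
def elimValue : ElimRing k n d M hM i :=
  -∑ m' : {m : M // m ≠ purePower n d M hM i}, X (Sum.inl m') * elimMonomial k n d M hM i m'.1.1.1

/-- The substitution on coefficients `R_M → B`: `a_m ↦ a_m` for `m ≠ d eᵢ`, `a_{d eᵢ} ↦ elimValue`.
[cite: Hartshorne1977, II Prop. 2.5] -/
def elimCoeffHom : CoeffRingM k n d M →ₐ[k] ElimRing k n d M hM i :=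
  aeval fun m : M =>
    if h : m = purePower n d M hM i then elimValue k n d M hM i else X (Sum.inl ⟨m, h⟩)

/-- `elimCoeffHom` on a surviving coefficient. [cite: Hartshorne1977, II Prop. 2.5] -/
theorem elimCoeffHom_X_of_ne {m : M} (h : m ≠ purePower n d M hM i) :
    elimCoeffHom k n d M hM i (X m) = X (Sum.inl ⟨m, h⟩) := by
  rw [elimCoeffHom, aeval_X, dif_neg h]

/-- `elimCoeffHom` on the eliminated coefficient. [cite: Hartshorne1977, II Prop. 2.5] -/
theorem elimCoeffHom_X_purePower :
    elimCoeffHom k n d M hM i (X (purePower n d M hM i)) = elimValue k n d M hM i := by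
  rw [elimCoeffHom, aeval_X, dif_pos rfl]

/-- **The elimination map** `φ : R_M[y] → B`, `a_m ↦ a_m` (`m ≠ d eᵢ`),
`a_{d eᵢ} ↦ -Σ' a_m x^m(xᵢ := 1)`, `yⱼ ↦ yⱼ` (Mathlib `aevalTower`). [cite: Hartshorne1977, II Prop. 2.5] -/
def elimHom : MvPolynomial (Fin (n + 1)) (CoeffRingM k n d M) →ₐ[k] ElimRing k n d M hM i :=
  aevalTower (elimCoeffHom k n d M hM i) fun j => X (Sum.inr j)

/-- `φ` on an affine coordinate. [cite: Hartshorne1977, II Prop. 2.5] -/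
@[simp]
theorem elimHom_X (j : Fin (n + 1)) : elimHom k n d M hM i (X j) = X (Sum.inr j) :=
  aevalTower_X _ _ _

/-- `φ` on a coefficient. [cite: Hartshorne1977, II Prop. 2.5] -/
@[simp]
theorem elimHom_C (a : CoeffRingM k n d M) :
    elimHom k n d M hM i (C a) = elimCoeffHom k n d M hM i a :=
  aevalTower_C _ _ _

/-- `φ` maps the dehomogenised monomials of `R_M[y]` to those of `B`. [cite: Hartshorne1977, II Prop. 2.5] -/
theorem elimHom_dehomMonomialAt (m : Fin (n + 2) →₀ ℕ) :
    elimHom k n d M hM i (dehomMonomialAt n i X m) = elimMonomial k n d M hM i m := by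
  rw [dehomMonomialAt, elimMonomial, dehomMonomialAt, Finsupp.prod, Finsupp.prod, map_prod]
  refine Finset.prod_congr rfl fun j _ => ?_
  rw [map_pow]
  congr 1
  rcases Fin.eq_self_or_eq_succAbove i j with rfl | ⟨j', rfl⟩
  · simp
  · simp

/-- **`f_i = a_{d eᵢ} + Σ_{m ≠ d eᵢ} a_m · x^m(xᵢ := 1)`**: the chart equation is linear in the
coefficient of `xᵢ^d`, with coefficient `1`. [cite: Hartshorne1977, II Prop. 2.5] -/
theorem chartFormM_eq_add :
    chartFormM k n d M i = C (X (purePower n d M hM i)) +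
      ∑ m' : {m : M // m ≠ purePower n d M hM i}, C (X m'.1) * dehomMonomialAt n i X m'.1.1.1 := by
  rw [chartFormM_eq, ← Finset.add_sum_erase _ _ (Finset.mem_univ (purePower n d M hM i)),
    purePower_val, dehomMonomialAt_single_self, mul_one,
    Finset.sum_subtype (Finset.univ.erase (purePower n d M hM i))
      (p := fun m => m ≠ purePower n d M hM i) (fun m => by simp)]

/-- **`φ` kills the chart equation**: `φ(f_i) = 0`. [cite: Hartshorne1977, II Prop. 2.5] -/
theorem elimHom_chartFormM : elimHom k n d M hM i (chartFormM k n d M i) = 0 := by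
  rw [chartFormM_eq_add, map_add, elimHom_C, elimCoeffHom_X_purePower, map_sum]
  simp_rw [map_mul, elimHom_C, elimHom_dehomMonomialAt]
  rw [elimValue, neg_add_eq_zero]
  exact Finset.sum_congr rfl fun m' _ => by rw [elimCoeffHom_X_of_ne k n d M hM i m'.2]

/-- The coordinate ring `R_M[y₀, …, yₙ] ⧸ (f_i)` of the chart `W_M ∩ D₊(xᵢ)` (up to the standard chart
isomorphism `(R_M[x]_{xᵢ})₀ ≅ R_M[y]`). [cite: Hartshorne1977, II Prop. 2.5] -/
abbrev ChartQuotM : Type u :=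
  MvPolynomial (Fin (n + 1)) (CoeffRingM k n d M) ⧸ Ideal.span {chartFormM k n d M i}

/-- `φ` descends to the quotient `R_M[y] ⧸ (f_i) → B`. [cite: Hartshorne1977, II Prop. 2.5] -/
def elimHomQuot : ChartQuotM k n d M i →ₐ[k] ElimRing k n d M hM i :=
  Ideal.Quotient.liftₐ (Ideal.span {chartFormM k n d M i}) (elimHom k n d M hM i) fun a ha => by
    obtain ⟨c, rfl⟩ := Ideal.mem_span_singleton'.mp ha
    rw [map_mul, elimHom_chartFormM, mul_zero]

/-- `elimHomQuot ∘ mk = φ`. [cite: Hartshorne1977, II Prop. 2.5] -/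
@[simp]
theorem elimHomQuot_mk (q : MvPolynomial (Fin (n + 1)) (CoeffRingM k n d M)) :
    elimHomQuot k n d M hM i (Ideal.Quotient.mk _ q) = elimHom k n d M hM i q :=
  rfl

/-- **The inverse** `χ : B → R_M[y] ⧸ (f_i)`, `a_m ↦ [a_m]`, `yⱼ ↦ [yⱼ]`. [cite: Hartshorne1977, II Prop. 2.5] -/
def elimInv : ElimRing k n d M hM i →ₐ[k] ChartQuotM k n d M i :=
  aeval (Sum.elim
    (fun m' : {m : M // m ≠ purePower n d M hM i} =>
      (Ideal.Quotient.mk (Ideal.span {chartFormM k n d M i}) (C (X m'.1)) : ChartQuotM k n d M i))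
    (fun j : Fin (n + 1) =>
      (Ideal.Quotient.mk (Ideal.span {chartFormM k n d M i}) (X j) : ChartQuotM k n d M i)))

/-- `χ` on a surviving coefficient. [cite: Hartshorne1977, II Prop. 2.5] -/
@[simp]
theorem elimInv_X_inl (m' : {m : M // m ≠ purePower n d M hM i}) :
    elimInv k n d M hM i (X (Sum.inl m')) =
      (Ideal.Quotient.mk (Ideal.span {chartFormM k n d M i}) (C (X m'.1)) : ChartQuotM k n d M i) := by
  rw [elimInv, aeval_X, Sum.elim_inl]

/-- `χ` on an affine coordinate. [cite: Hartshorne1977, II Prop. 2.5] -/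
@[simp]
theorem elimInv_X_inr (j : Fin (n + 1)) :
    elimInv k n d M hM i (X (Sum.inr j)) =
      (Ideal.Quotient.mk (Ideal.span {chartFormM k n d M i}) (X j) : ChartQuotM k n d M i) := by
  rw [elimInv, aeval_X, Sum.elim_inr]

/-- `χ` on the dehomogenised monomials. [cite: Hartshorne1977, II Prop. 2.5] -/
theorem elimInv_elimMonomial (m : Fin (n + 2) →₀ ℕ) :
    elimInv k n d M hM i (elimMonomial k n d M hM i m) =
      (Ideal.Quotient.mk (Ideal.span {chartFormM k n d M i}) (dehomMonomialAt n i X m) :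
        ChartQuotM k n d M i) := by
  rw [elimMonomial, dehomMonomialAt, dehomMonomialAt, Finsupp.prod, Finsupp.prod, map_prod, map_prod]
  refine Finset.prod_congr rfl fun j _ => ?_
  rw [map_pow, map_pow]
  congr 1
  rcases Fin.eq_self_or_eq_succAbove i j with rfl | ⟨j', rfl⟩
  · simp
  · simp

/-- `φ ∘ χ = id_B`. [cite: Hartshorne1977, II Prop. 2.5] -/
theorem elimHomQuot_comp_elimInv :
    (elimHomQuot k n d M hM i).comp (elimInv k n d M hM i) = AlgHom.id k _ := by
  refine MvPolynomial.algHom_ext fun v => ?_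
  rcases v with m' | j
  · rw [AlgHom.comp_apply, elimInv_X_inl, elimHomQuot_mk, elimHom_C, elimCoeffHom_X_of_ne _ _ _ _ _ _ m'.2,
      AlgHom.id_apply]
  · rw [AlgHom.comp_apply, elimInv_X_inr, elimHomQuot_mk, elimHom_X, AlgHom.id_apply]

/-- In `R_M[y] ⧸ (f_i)`: `[a_{d eᵢ}] = -Σ_{m ≠ d eᵢ} [a_m] [x^m(xᵢ := 1)]`. [cite: Hartshorne1977, II Prop. 2.5] -/
theorem mk_C_X_purePower :
    (Ideal.Quotient.mk (Ideal.span {chartFormM k n d M i}) (C (X (purePower n d M hM i))) :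
        ChartQuotM k n d M i) =
      Ideal.Quotient.mk _ (-∑ m' : {m : M // m ≠ purePower n d M hM i},
        C (X m'.1) * dehomMonomialAt n i X m'.1.1.1) := by
  rw [Ideal.Quotient.eq, sub_neg_eq_add, ← chartFormM_eq_add]
  exact Ideal.subset_span rfl

/-- `χ (φ (a_m)) = [a_m]` for every coefficient. [cite: Hartshorne1977, II Prop. 2.5] -/
theorem elimInv_elimHom_C_X (m : M) :
    elimInv k n d M hM i (elimHom k n d M hM i (C (X m))) =
      (Ideal.Quotient.mk (Ideal.span {chartFormM k n d M i}) (C (X m)) : ChartQuotM k n d M i) := by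
  rw [elimHom_C]
  by_cases h : m = purePower n d M hM i
  · rw [h, elimCoeffHom_X_purePower, mk_C_X_purePower, elimValue, map_neg, map_neg, map_sum,
      map_sum]
    refine congrArg Neg.neg (Finset.sum_congr rfl fun m' _ => ?_)
    rw [map_mul, map_mul, elimInv_X_inl, elimInv_elimMonomial]
  · rw [elimCoeffHom_X_of_ne _ _ _ _ _ _ h, elimInv_X_inl]

/-- `χ (φ (yⱼ)) = [yⱼ]` for every affine coordinate. [cite: Hartshorne1977, II Prop. 2.5] -/
theorem elimInv_elimHom_X (j : Fin (n + 1)) :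
    elimInv k n d M hM i (elimHom k n d M hM i (X j)) =
      (Ideal.Quotient.mk (Ideal.span {chartFormM k n d M i}) (X j) : ChartQuotM k n d M i) := by
  rw [elimHom_X, elimInv_X_inr]

/-- `χ ∘ φ = id` on `R_M[y] ⧸ (f_i)`. [cite: Hartshorne1977, II Prop. 2.5] -/
theorem elimInv_comp_elimHomQuot :
    (elimInv k n d M hM i).comp (elimHomQuot k n d M hM i) = AlgHom.id k _ := by
  apply Ideal.Quotient.algHom_ext k
  refine MvPolynomial.algHom_ext' (R := k) (σ := Fin (n + 1)) (A := CoeffRingM k n d M)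
    (B := ChartQuotM k n d M i) ?_ (fun j => ?_)
  · refine MvPolynomial.algHom_ext fun m => ?_
    simp only [AlgHom.comp_apply, IsScalarTower.toAlgHom_apply, MvPolynomial.algebraMap_eq,
      Ideal.Quotient.mkₐ_eq_mk, AlgHom.id_apply, elimHomQuot_mk]
    exact elimInv_elimHom_C_X k n d M hM i m
  · simp only [AlgHom.comp_apply, Ideal.Quotient.mkₐ_eq_mk, AlgHom.id_apply, elimHomQuot_mk]
    exact elimInv_elimHom_X k n d M hM i j

/-- **Elimination of `a_{d eᵢ}`**: `R_M[y₀, …, yₙ] ⧸ (f_i) ≅ k[a_m (m ≠ d eᵢ), y₀, …, yₙ]` as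
`k`-algebras — the chart `W_M ∩ D₊(xᵢ)` is an affine space. [cite: Hartshorne1977, II Prop. 2.5] -/
def elimEquiv : ChartQuotM k n d M i ≃ₐ[k] ElimRing k n d M hM i :=
  AlgEquiv.ofAlgHom (elimHomQuot k n d M hM i) (elimInv k n d M hM i)
    (elimHomQuot_comp_elimInv k n d M hM i) (elimInv_comp_elimHomQuot k n d M hM i)

include hM in
/-- `R_M[y] ⧸ (f_i)` is a domain. [cite: Hartshorne1977, II Prop. 2.5] -/
theorem isDomain_chartQuotM : IsDomain (ChartQuotM k n d M i) :=
  MulEquiv.isDomain (ElimRing k n d M hM i) (elimEquiv k n d M hM i).toMulEquiv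

include hM in
/-- `R_M[y] ⧸ (f_i)` is reduced. [cite: Hartshorne1977, II Prop. 2.5] -/
theorem isReduced_chartQuotM : IsReduced (ChartQuotM k n d M i) :=
  haveI := isDomain_chartQuotM k n d M hM i
  inferInstance

include hM in
/-- Hence `(f_i)` is a radical ideal of `R_M[y]`. [cite: Hartshorne1977, II Prop. 2.5] -/
theorem radical_span_chartFormM :
    (Ideal.span {chartFormM k n d M i}).radical = Ideal.span {chartFormM k n d M i} :=
  haveI := isReduced_chartQuotM k n d M hM i
  Ideal.radical_eq_iff.mpr ((Ideal.isRadical_iff_quotient_reduced _).mpr this)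

/-- `|M| ≥ 1` under base-point freeness. [cite: VoisinHodgeII2003, §6.2.1] -/
theorem one_le_card (hM : IsBasePointFree n d M) : 1 ≤ Nat.card M :=
  haveI : Nonempty M := ⟨purePower n d M hM 0⟩
  Nat.card_pos

/-- The surviving variables number `|M| - 1 + (n + 1) = |M| + n`. [cite: Hartshorne1977, II Prop. 2.5] -/
theorem card_elimVars : Fintype.card (ElimVars n d M hM i) = Nat.card M + n := by
  rw [Fintype.card_sum, Fintype.card_fin, Fintype.card_subtype_compl, Fintype.card_subtype_eq,
    ← Nat.card_eq_fintype_card]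
  have := one_le_card n d M hM
  omega

include hM in
/-- **`R_M[y] ⧸ (f_i)` is standard smooth over `k` of relative dimension `|M| + n`** (a polynomial
ring in that many variables). [cite: Hartshorne1977, III §10 Example 10.0.1] -/
theorem isStandardSmoothOfRelativeDimension_chartQuotM :
    Algebra.IsStandardSmoothOfRelativeDimension (Nat.card M + n) k (ChartQuotM k n d M i) := by
  haveI := ProjectiveSpace.isStandardSmoothOfRelativeDimension_mvPolynomial_fin k (Nat.card M + n)
  have e : ElimVars n d M hM i ≃ Fin (Nat.card M + n) :=
    (Fintype.equivFin _).trans (finCongr (card_elimVars n d M hM i))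
  haveI : Algebra.IsStandardSmoothOfRelativeDimension (Nat.card M + n) k (ElimRing k n d M hM i) :=
    Algebra.IsStandardSmoothOfRelativeDimension.of_algEquiv (Nat.card M + n)
      (MvPolynomial.renameEquiv k e).symm
  exact Algebra.IsStandardSmoothOfRelativeDimension.of_algEquiv (Nat.card M + n)
    (elimEquiv k n d M hM i).symm

end Elimination

/-! ### The chart `W_M ∩ D₊(xᵢ)` is the affine space `Spec (R_M[y] ⧸ (f_i))` -/

section Chart

variable (k : Type u) [Field k] (n d : ℕ) (M : Set (DegIndex n d)) (hM : IsBasePointFree n d M)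
  (i : Fin (n + 2))

attribute [local instance] MvPolynomial.gradedAlgebra ProjBaseChange.algebraBase
  ProjBaseChange.isScalarTower_localization

/-- graded pieces of `R[x₀, …, x_{n+1}]` -/
local notation "𝒜" R => MvPolynomial.homogeneousSubmodule (Fin (n + 2)) R

/-- The chart `D₊(xᵢ)` of `ℙⁿ⁺¹_{R_M}` as an affine open (Hartshorne II Prop. 2.5(b)).
[cite: Hartshorne1977, II Prop. 2.5] -/
abbrev coordChartOpenM : (projSp n (CoeffRingM k n d M)).affineOpens :=
  ProjSubscheme.affineBasicOpen (𝒜 (CoeffRingM k n d M)) (X i) (ProjectiveSpace.X_mem i) one_pos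

/-- The chart algebra `S_i = (R_M[x]_{xᵢ})₀` of `D₊(xᵢ)`. [cite: Hartshorne1977, II Prop. 2.5] -/
abbrev ChartAlgM : Type u := Away (𝒜 (CoeffRingM k n d M)) (X i)

/-- The chart equation `F_M / xᵢᵈ ∈ S_i` (Mathlib `Away.isLocalizationElem`). [cite: Hartshorne1977, II Prop. 2.5] -/
abbrev chartEqnM : ChartAlgM k n d M i :=
  Away.isLocalizationElem (ProjectiveSpace.X_mem i) (universalFormM_mem k n d M)

/-- Under the standard chart isomorphism `S_i ≅ R_M[y₀, …, yₙ]` (`ProjectiveSpace.chartAlgEquiv`,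
Hartshorne I Thm. 3.4) the chart equation `F_M / xᵢᵈ` is the dehomogenised form `f_i`.
[cite: Hartshorne1977, I Thm. 3.4 (proof)] -/
theorem chartAlgEquiv_chartEqnM :
    ProjectiveSpace.chartAlgEquiv (CoeffRingM k n d M) i (chartEqnM k n d M i) =
      chartFormM k n d M i := by
  rw [chartEqnM, ProjectiveSpace.isLocalizationElem_X i _ (universalFormM_mem k n d M), chartFormM,
    ProjectiveSpace.chartAlgEquiv, AlgEquiv.ofAlgHom_apply]
  generalize ProjectiveSpace.dehomogenize (CoeffRingM k n d M) i (universalFormM k n d M) = p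
  have h := AlgHom.congr_fun (ProjectiveSpace.ofChart_comp_toChart (CoeffRingM k n d M) i) p
  rw [AlgHom.comp_apply, AlgHom.id_apply] at h
  exact h

/-- Equivalently `(S_i ≅ R_M[y])⁻¹ (f_i) = F_M / xᵢᵈ`. [cite: Hartshorne1977, I Thm. 3.4 (proof)] -/
theorem chartAlgEquiv_symm_chartFormM :
    (ProjectiveSpace.chartAlgEquiv (CoeffRingM k n d M) i).symm (chartFormM k n d M i) =
      chartEqnM k n d M i := by
  rw [← chartAlgEquiv_chartEqnM, AlgEquiv.symm_apply_apply]

/-- The ideal `(f_i) ⊆ R_M[y]` is the image of `(F_M/xᵢᵈ) ⊆ S_i` under the chart isomorphism.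
[cite: Hartshorne1977, I Thm. 3.4 (proof)] -/
theorem map_span_chartEqnM :
    Ideal.map (ProjectiveSpace.chartAlgEquiv (CoeffRingM k n d M) i) (Ideal.span {chartEqnM k n d M i}) =
      Ideal.span {chartFormM k n d M i} := by
  rw [Ideal.map_span, Set.image_singleton, chartAlgEquiv_chartEqnM]

/-- **`S_i ⧸ (F_M/xᵢᵈ) ≅ R_M[y] ⧸ (f_i)`** as `R_M`-algebras (quotients along the chart isomorphism).
[cite: Hartshorne1977, II Prop. 2.5] -/
def chartQuotEquivM :
    (ChartAlgM k n d M i ⧸ Ideal.span {chartEqnM k n d M i}) ≃ₐ[CoeffRingM k n d M]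
      ChartQuotM k n d M i :=
  Ideal.quotientEquivAlg (Ideal.span {chartEqnM k n d M i}) (Ideal.span {chartFormM k n d M i})
    (ProjectiveSpace.chartAlgEquiv (CoeffRingM k n d M) i) (map_span_chartEqnM k n d M i).symm

include hM in
/-- `S_i ⧸ (F_M/xᵢᵈ)` is reduced (it is a polynomial ring over `k`). [cite: Hartshorne1977, II Prop. 2.5] -/
theorem isReduced_chartAlgM_quot :
    IsReduced (ChartAlgM k n d M i ⧸ Ideal.span {chartEqnM k n d M i}) :=
  haveI := isReduced_chartQuotM k n d M hM i
  isReduced_of_injective (chartQuotEquivM k n d M i) (chartQuotEquivM k n d M i).injective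

include hM in
/-- Hence `(F_M/xᵢᵈ)` is a radical ideal of `S_i`. [cite: Hartshorne1977, II Prop. 2.5] -/
theorem radical_span_chartEqnM :
    (Ideal.span {chartEqnM k n d M i}).radical = Ideal.span {chartEqnM k n d M i} :=
  haveI := isReduced_chartAlgM_quot k n d M hM i
  Ideal.radical_eq_iff.mpr ((Ideal.isRadical_iff_quotient_reduced _).mpr this)

/-- **The reduced induced ideal over `D₊(xᵢ)`** (Hartshorne II Example 3.2.6): through
`S_i ≅ Γ(D₊(xᵢ))`, the ideal of sections of the vanishing ideal sheaf of `V₊(F_M)` over `D₊(xᵢ)` is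
`√(F_M/xᵢᵈ)` (`ProjSubscheme.vanishingIdeal_ideal_affineBasicOpen`, `awayι_preimage_zeroLocus` and
`I(V(g)) = √(g)` for prime spectra). [cite: Hartshorne1977, II Example 3.2.6] -/
theorem ideal_coordChartOpenM_eq_map_radical (hd : 0 < d) :
    (idealSheafM k n d M).ideal (coordChartOpenM k n d M i) =
      Ideal.map (Proj.awayToSection (𝒜 (CoeffRingM k n d M)) (X i)).hom
        (Ideal.span {chartEqnM k n d M i}).radical := by
  have hpre := ProjSubscheme.awayι_preimage_zeroLocus (𝒜 (CoeffRingM k n d M))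
    (ProjectiveSpace.X_mem i) one_pos (universalFormM_mem k n d M) hd
  rw [idealSheafM, ProjSubscheme.vanishingIdeal_ideal_affineBasicOpen]
  congr 1
  rw [← PrimeSpectrum.vanishingIdeal_zeroLocus_eq_radical, PrimeSpectrum.zeroLocus_span]
  exact congrArg PrimeSpectrum.vanishingIdeal hpre

include hM in
/-- **`W_M` on the chart is `f_i = 0`**: the ideal of the reduced structure on `V₊(F_M) ∩ D₊(xᵢ)` is
`(F_M/xᵢᵈ)` itself. [cite: Hartshorne1977, II Example 3.2.6] -/
theorem ideal_coordChartOpenM_eq (hd : 0 < d) :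
    (idealSheafM k n d M).ideal (coordChartOpenM k n d M i) =
      Ideal.map (Proj.awayToSection (𝒜 (CoeffRingM k n d M)) (X i)).hom
        (Ideal.span {chartEqnM k n d M i}) := by
  rw [ideal_coordChartOpenM_eq_map_radical k n d M i hd, radical_span_chartEqnM k n d M hM i]

/-- The ring map `k → R_M → S_i ≅ Γ(D₊(xᵢ)) → Γ(D₊(xᵢ))/𝓘(D₊(xᵢ))` whose `Spec` is the chart of `W_M`
over `D₊(xᵢ)` followed by `W_M → 𝔸^M → Spec k` (`subschemePieceM_hom`). [cite: Hartshorne1977, II Prop. 5.9] -/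
def chartRingHomM : k →+*
    (Γ(projSp n (CoeffRingM k n d M),
        (coordChartOpenM k n d M i : (projSp n (CoeffRingM k n d M)).Opens)) ⧸
      (idealSheafM k n d M).ideal (coordChartOpenM k n d M i)) :=
  (Ideal.Quotient.mk _).comp
    ((Proj.awayToSection (𝒜 (CoeffRingM k n d M)) (X i)).hom.comp
      ((algebraMap (CoeffRingM k n d M) (ChartAlgM k n d M i)).comp
        (algebraMap k (CoeffRingM k n d M))))

/-- The chart `Spec (Γ(D₊(xᵢ))/𝓘) → W_M → 𝔸^M → Spec k` is `Spec` of `chartRingHomM`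
(`ProjSubscheme.subschemePiece_ι_toSpecZero`). [cite: Hartshorne1977, II Prop. 5.9] -/
theorem subschemePieceM_hom :
    ProjSubscheme.subschemePiece (idealSheafM k n d M) (coordChartOpenM k n d M i) ≫
        (incidenceOverM k n d M).hom =
      Spec.map (CommRingCat.ofHom (chartRingHomM k n d M i)) := by
  change ProjSubscheme.subschemePiece (idealSheafM k n d M) (coordChartOpenM k n d M i) ≫
    ((idealSheafM k n d M).subschemeι ≫ Proj.toSpecZero (𝒜 (CoeffRingM k n d M)) ≫
      Spec.map (CommRingCat.ofHom (algebraMap (CoeffRingM k n d M) _))) ≫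
        specMToSpec k n d M = _
  simp only [Category.assoc]
  rw [reassoc_of% ProjSubscheme.subschemePiece_ι_toSpecZero (𝒜 (CoeffRingM k n d M)) (X i)
      (ProjectiveSpace.X_mem i) one_pos (idealSheafM k n d M),
    ← Spec.map_comp, ← Spec.map_comp]
  rfl

/-- The chart isomorphism `S_i ≃ Γ(D₊(xᵢ))` as a ring equivalence (Mathlib `Proj.basicOpenIsoAway`).
[cite: Hartshorne1977, II Prop. 2.5] -/
def awayEquivSectionsM : ChartAlgM k n d M i ≃+*
    Γ(projSp n (CoeffRingM k n d M), (coordChartOpenM k n d M i : (projSp n (CoeffRingM k n d M)).Opens)) :=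
  (Proj.basicOpenIsoAway (𝒜 (CoeffRingM k n d M)) (X i) (ProjectiveSpace.X_mem i)
    one_pos).commRingCatIsoToRingEquiv

/-- **`S_i ⧸ (F_M/xᵢᵈ) ≅ Γ(D₊(xᵢ)) ⧸ 𝓘(D₊(xᵢ))`** (Mathlib `Ideal.quotientEquiv` along `S_i ≅ Γ(D₊(xᵢ))`;
Hartshorne II Prop. 5.9: a closed subscheme is `Spec (A/𝔞)` over each affine open).
[cite: Hartshorne1977, II Prop. 5.9] -/
def chartSectionsQuotEquivM (hd : 0 < d) :
    (ChartAlgM k n d M i ⧸ Ideal.span {chartEqnM k n d M i}) ≃+*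
      Γ(projSp n (CoeffRingM k n d M),
          (coordChartOpenM k n d M i : (projSp n (CoeffRingM k n d M)).Opens)) ⧸
        (idealSheafM k n d M).ideal (coordChartOpenM k n d M i) :=
  Ideal.quotientEquiv _ _ (awayEquivSectionsM k n d M i) (by
    rw [ideal_coordChartOpenM_eq k n d M hM i hd]
    rfl)

/-- **The coordinate ring `Γ(D₊(xᵢ)) ⧸ 𝓘` of the chart `W_M ∩ D₊(xᵢ)` is the polynomial ring
`k[a_m (m ≠ d eᵢ), y₀, …, yₙ]`** (composite of the three identifications). [cite: Hartshorne1977, II Prop. 5.9] -/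
def chartSectionsQuotEquivElimM (hd : 0 < d) :
    (Γ(projSp n (CoeffRingM k n d M),
          (coordChartOpenM k n d M i : (projSp n (CoeffRingM k n d M)).Opens)) ⧸
        (idealSheafM k n d M).ideal (coordChartOpenM k n d M i)) ≃+* ElimRing k n d M hM i :=
  ((chartSectionsQuotEquivM k n d M hM i hd).symm.trans (chartQuotEquivM k n d M i).toRingEquiv).trans
    (elimEquiv k n d M hM i).toRingEquiv

include hM in
/-- Hence `Γ(D₊(xᵢ)) ⧸ 𝓘` is a domain. [cite: Hartshorne1977, II Prop. 5.9] -/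
theorem isDomain_chartSectionsQuot (hd : 0 < d) :
    IsDomain (Γ(projSp n (CoeffRingM k n d M),
          (coordChartOpenM k n d M i : (projSp n (CoeffRingM k n d M)).Opens)) ⧸
        (idealSheafM k n d M).ideal (coordChartOpenM k n d M i)) :=
  MulEquiv.isDomain (ElimRing k n d M hM i) (chartSectionsQuotEquivElimM k n d M hM i hd).toMulEquiv

include hM in
/-- **The chart ring map `k → Γ(D₊(xᵢ))/𝓘` is standard smooth of relative dimension `|M| + n`**:
up to `Γ(D₊(xᵢ))/𝓘 ≅ S_i/(F_M/xᵢᵈ) ≅ R_M[y]/(f_i) ≅ k[a_m (m ≠ d eᵢ), y]` it is the structure map of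
a polynomial ring. [cite: Hartshorne1977, III §10 Example 10.0.1] -/
theorem isStandardSmoothOfRelativeDimension_chartRingHomM (hd : 0 < d) :
    (chartRingHomM k n d M i).IsStandardSmoothOfRelativeDimension (Nat.card M + n) := by
  have hQ := (RingHom.isStandardSmoothOfRelativeDimension_algebraMap (R := k)
    (S := ChartQuotM k n d M i) (Nat.card M + n)).mpr
    (isStandardSmoothOfRelativeDimension_chartQuotM k n d M hM i)
  have hcomp : chartRingHomM k n d M i =
      ((chartSectionsQuotEquivM k n d M hM i hd).toRingHom.comp
          (chartQuotEquivM k n d M i).symm.toRingEquiv.toRingHom).comp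
        (algebraMap k (ChartQuotM k n d M i)) := by
    refine RingHom.ext fun r => ?_
    change chartRingHomM k n d M i r = chartSectionsQuotEquivM k n d M hM i hd
      ((chartQuotEquivM k n d M i).symm (algebraMap k (ChartQuotM k n d M i) r))
    rw [IsScalarTower.algebraMap_apply k (CoeffRingM k n d M) (ChartQuotM k n d M i),
      AlgEquiv.commutes, Ideal.Quotient.alg_map_eq, RingHom.comp_apply, Ideal.Quotient.algebraMap_eq,
      chartSectionsQuotEquivM, Ideal.quotientEquiv_mk]
    rfl
  rw [hcomp]
  exact RingHom.isStandardSmoothOfRelativeDimension_respectsIso.1 _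
    ((chartQuotEquivM k n d M i).symm.toRingEquiv.trans (chartSectionsQuotEquivM k n d M hM i hd)) hQ

include hM in
/-- **The chart of `W_M` over `D₊(xᵢ)` is smooth over `k` of relative dimension `|M| + n`.**
[cite: Hartshorne1977, III Thm. 10.2] -/
theorem smoothOfRelativeDimension_subschemePieceM (hd : 0 < d) :
    SmoothOfRelativeDimension (Nat.card M + n)
      (ProjSubscheme.subschemePiece (idealSheafM k n d M) (coordChartOpenM k n d M i) ≫
        (incidenceOverM k n d M).hom) := by
  rw [subschemePieceM_hom, HasRingHomProperty.Spec_iff (P := @SmoothOfRelativeDimension (Nat.card M + n))]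
  exact RingHom.locally_of RingHom.isStandardSmoothOfRelativeDimension_respectsIso _
    (isStandardSmoothOfRelativeDimension_chartRingHomM k n d M hM i hd)

end Chart

/-! ### `W_M` is smooth over `k` and irreducible -/

section Smooth

variable (k : Type u) [Field k] (n d : ℕ) (M : Set (DegIndex n d)) (hM : IsBasePointFree n d M)

attribute [local instance] MvPolynomial.gradedAlgebra ProjBaseChange.algebraBase
  ProjBaseChange.isScalarTower_localization

/-- graded pieces of `R[x₀, …, x_{n+1}]` -/
local notation "𝒜" R => MvPolynomial.homogeneousSubmodule (Fin (n + 2)) R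

/-- The charts `D₊(x₀), …, D₊(x_{n+1})` cover `ℙⁿ⁺¹_{R_M}` (a relevant prime does not contain every
variable, the irrelevant ideal being contained in `(x₀, …, x_{n+1})`). [cite: Hartshorne1977, II Prop. 2.5] -/
theorem exists_mem_coordChart (p : projSp n (CoeffRingM k n d M)) :
    ∃ i : Fin (n + 2), p ∈ Proj.basicOpen (𝒜 (CoeffRingM k n d M)) (X i) := by
  by_contra! H
  simp only [Proj.mem_basicOpen, not_not] at H
  refine p.not_irrelevant_le fun a ha => ?_
  exact Ideal.span_le.mpr (Set.range_subset_iff.mpr H)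
    (ProjBaseChangeRing.irrelevant_le_span_X (CoeffRingM k n d M) ha)

include hM in
/-- **The incidence variety `W_M` of a base-point-free monomial system is smooth over `k` of relative
dimension `|M| + n`** (`= dim 𝔸^M + dim ℙⁿ⁺¹ - 1`): it is covered by the charts over `D₊(xᵢ)`, each an
affine space `𝔸^{|M| + n}` (elimination of `a_{d eᵢ}`); smoothness is Zariski-local at the source.
Geometrically: `W_M → ℙⁿ⁺¹` is the bundle of hyperplanes `{a | Σ a_m x^m = 0} ⊆ 𝔸^M`.
[cite: Hartshorne1977, III Thm. 10.2] [cite: VoisinHodgeII2003, §2.1.1 eq. (2.2)] -/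
theorem smoothOfRelativeDimension_incidenceOverM_hom (hd : 0 < d) :
    SmoothOfRelativeDimension (Nat.card M + n) (incidenceOverM k n d M).hom := by
  let piece : ∀ i : Fin (n + 2), _ := fun i =>
    ProjSubscheme.subschemePiece (idealSheafM k n d M) (coordChartOpenM k n d M i)
  let 𝒱 : (incidenceM k n d M).OpenCover :=
    Scheme.Cover.mkOfCovers (Fin (n + 2)) _ (fun i => piece i)
      (fun x => by
        obtain ⟨i, hi⟩ := exists_mem_coordChart k n d M (incidenceιM k n d M x)
        have hx : x ∈ (piece i).opensRange := by
          rw [ProjSubscheme.opensRange_subschemePiece]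
          exact hi
        obtain ⟨y, hy⟩ := hx
        exact ⟨i, y, hy⟩)
      (fun i => inferInstance)
  exact IsZariskiLocalAtSource.of_openCover (P := @SmoothOfRelativeDimension (Nat.card M + n)) 𝒱
    fun i => smoothOfRelativeDimension_subschemePieceM k n d M hM i hd

include hM in
/-- `W_M` is smooth over `k`. [cite: Hartshorne1977, III Thm. 10.2] -/
theorem smooth_incidenceOverM_hom (hd : 0 < d) : Smooth (incidenceOverM k n d M).hom :=
  haveI := smoothOfRelativeDimension_incidenceOverM_hom k n d M hM hd
  SmoothOfRelativeDimension.smooth (Nat.card M + n) _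

/-! #### A point of `W_M` in every chart: `(a = 0, x = (1 : ⋯ : 1))` -/

/-- The ring map `R_M[x₀, …, x_{n+1}] → k[t]`, `a_m ↦ 0`, `xⱼ ↦ t`, whose kernel gives the point
`(a = 0, x = (1 : ⋯ : 1))` of `W_M`. [cite: Hartshorne1977, II Prop. 2.5] -/
def diagEvalM : MvPolynomial (Fin (n + 2)) (CoeffRingM k n d M) →+* Polynomial k :=
  eval₂Hom (Polynomial.C.comp (MvPolynomial.eval fun _ : M => (0 : k))) fun _ => Polynomial.X

/-- `a_m ↦ 0`. [cite: Hartshorne1977, II Prop. 2.5] -/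
@[simp]
theorem diagEvalM_C_X (m : M) : diagEvalM k n d M (C (X m)) = 0 := by
  simp [diagEvalM]

/-- `xⱼ ↦ t`. [cite: Hartshorne1977, II Prop. 2.5] -/
@[simp]
theorem diagEvalM_X (j : Fin (n + 2)) : diagEvalM k n d M (X j) = Polynomial.X := by
  simp [diagEvalM]

/-- `F_M ↦ 0` (every term carries a coefficient `a_m ↦ 0`). [cite: Hartshorne1977, II Prop. 2.5] -/
theorem diagEvalM_universalFormM : diagEvalM k n d M (universalFormM k n d M) = 0 := by
  rw [universalFormM, map_sum]
  refine Finset.sum_eq_zero fun m _ => ?_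
  rw [← mul_one (X m), ← C_mul_monomial, map_mul, diagEvalM_C_X, zero_mul]

/-- The homogeneous prime `𝔮 = core(ker(a ↦ 0, xⱼ ↦ t))` of `R_M[x]`. [cite: Hartshorne1977, II Prop. 2.5] -/
def diagHomogeneousIdealM : HomogeneousIdeal (𝒜 (CoeffRingM k n d M)) :=
  (RingHom.ker (diagEvalM k n d M)).homogeneousCore (𝒜 (CoeffRingM k n d M))

/-- `𝔮` is prime (the kernel of a map to the domain `k[t]` is prime, and so is its homogeneous
core). [cite: Hartshorne1977, II Prop. 2.5] -/
theorem isPrime_diagHomogeneousIdealM : (diagHomogeneousIdealM k n d M).toIdeal.IsPrime :=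
  (RingHom.ker_isPrime (diagEvalM k n d M)).homogeneousCore

/-- `xᵢ ∉ 𝔮` (its image `t` is non-zero). [cite: Hartshorne1977, II Prop. 2.5] -/
theorem X_not_mem_diagHomogeneousIdealM (i : Fin (n + 2)) :
    (X i : MvPolynomial (Fin (n + 2)) (CoeffRingM k n d M)) ∉ diagHomogeneousIdealM k n d M := by
  intro h
  have h' := Ideal.toIdeal_homogeneousCore_le (𝒜 (CoeffRingM k n d M)) _
    (HomogeneousIdeal.mem_iff.mpr h)
  rw [RingHom.mem_ker, diagEvalM_X] at h'
  exact Polynomial.X_ne_zero h'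

/-- `F_M ∈ 𝔮` (homogeneous and in the kernel). [cite: Hartshorne1977, II Prop. 2.5] -/
theorem universalFormM_mem_diagHomogeneousIdealM :
    universalFormM k n d M ∈ diagHomogeneousIdealM k n d M :=
  Ideal.mem_homogeneousCore_of_homogeneous_of_mem ⟨d, universalFormM_mem k n d M⟩
    (by rw [RingHom.mem_ker]; exact diagEvalM_universalFormM k n d M)

/-- **The point `(a = 0, x = (1 : ⋯ : 1))` of `ℙⁿ⁺¹_{R_M}`** (as the relevant homogeneous prime `𝔮`).
[cite: Hartshorne1977, II Prop. 2.5] -/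
def diagPointM : projSp n (CoeffRingM k n d M) where
  asHomogeneousIdeal := diagHomogeneousIdealM k n d M
  isPrime := isPrime_diagHomogeneousIdealM k n d M
  not_irrelevant_le h :=
    X_not_mem_diagHomogeneousIdealM k n d M 0
      (h (HomogeneousIdeal.mem_irrelevant_of_mem _ zero_lt_one (ProjectiveSpace.X_mem 0)))

/-- The point lies on `V₊(F_M)`. [cite: Hartshorne1977, II Prop. 2.5] -/
theorem diagPointM_mem_zeroLocus :
    diagPointM k n d M ∈
      ProjectiveSpectrum.zeroLocus (𝒜 (CoeffRingM k n d M)) {universalFormM k n d M} := by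
  change ({universalFormM k n d M} : Set _) ⊆ ((diagPointM k n d M).asHomogeneousIdeal : Set _)
  exact Set.singleton_subset_iff.mpr (universalFormM_mem_diagHomogeneousIdealM k n d M)

/-- The point lies in every chart `D₊(xᵢ)`. [cite: Hartshorne1977, II Prop. 2.5] -/
theorem diagPointM_mem_basicOpen (i : Fin (n + 2)) :
    diagPointM k n d M ∈ Proj.basicOpen (𝒜 (CoeffRingM k n d M)) (X i) :=
  X_not_mem_diagHomogeneousIdealM k n d M i

/-- **A point of `W_M` lying in every chart.** [cite: Hartshorne1977, II Prop. 2.5] -/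
theorem exists_point_mem_forall_chart :
    ∃ w : incidenceM k n d M, ∀ i : Fin (n + 2),
      incidenceιM k n d M w ∈ Proj.basicOpen (𝒜 (CoeffRingM k n d M)) (X i) := by
  obtain ⟨w, hw⟩ : diagPointM k n d M ∈ Set.range (incidenceιM k n d M) := by
    rw [range_incidenceιM]
    exact diagPointM_mem_zeroLocus k n d M
  exact ⟨w, fun i => hw ▸ diagPointM_mem_basicOpen k n d M i⟩

include hM in
/-- Each chart `W_M ∩ D₊(xᵢ)` is irreducible (the image of `Spec` of the domain `Γ(D₊(xᵢ))/𝓘 ≅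
k[a_m (m ≠ d eᵢ), y]`). [cite: Hartshorne1977, I Example 1.1.3] -/
theorem isIrreducible_chart (hd : 0 < d) (i : Fin (n + 2)) :
    IsIrreducible ((incidenceιM k n d M ⁻¹ᵁ
      (coordChartOpenM k n d M i : (projSp n (CoeffRingM k n d M)).Opens) :
        (incidenceM k n d M).Opens) : Set (incidenceM k n d M)) := by
  haveI := isDomain_chartSectionsQuot k n d M hM i hd
  rw [← ProjSubscheme.opensRange_subschemePiece]
  have h := (IrreducibleSpace.isIrreducible_univ _).image _
    (ProjSubscheme.subschemePiece (idealSheafM k n d M) (coordChartOpenM k n d M i)).continuous.continuousOn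
  rw [Set.image_univ] at h
  exact h

include hM in
/-- **The incidence variety `W_M` is irreducible**: it is the union of the irreducible open charts
`W_M ∩ D₊(xᵢ)`, which pairwise meet (all contain the point `(a = 0, x = (1 : ⋯ : 1))`).
[cite: Hartshorne1977, I Example 1.1.3] -/
theorem irreducibleSpace_incidenceM (hd : 0 < d) : IrreducibleSpace (incidenceM k n d M) := by
  obtain ⟨w₀, hw₀⟩ := exists_point_mem_forall_chart k n d M
  let U : Fin (n + 2) → Set (incidenceM k n d M) := fun i =>
    ((incidenceιM k n d M ⁻¹ᵁ
      (coordChartOpenM k n d M i : (projSp n (CoeffRingM k n d M)).Opens) :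
        (incidenceM k n d M).Opens) : Set (incidenceM k n d M))
  have hUo : ∀ i, IsOpen (U i) := fun i => (incidenceιM k n d M ⁻¹ᵁ _).isOpen
  have hUirr : ∀ i, IsIrreducible (U i) := fun i => isIrreducible_chart k n d M hM hd i
  have hw₀U : ∀ i, w₀ ∈ U i := hw₀
  have hcov : ∀ x : incidenceM k n d M, ∃ i, x ∈ U i := fun x =>
    exists_mem_coordChart k n d M (incidenceιM k n d M x)
  haveI : PreirreducibleSpace (incidenceM k n d M) := by
    refine PreirreducibleSpace.of_forall_nonempty_inter fun A B hA hB ⟨a, ha⟩ ⟨b, hb⟩ => ?_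
    obtain ⟨i, hi⟩ := hcov a
    obtain ⟨j, hj⟩ := hcov b
    -- `A` meets `U j`: inside the irreducible `U i`, the opens `A` and `U j` are both non-empty
    obtain ⟨c, hcUi, hcA, hcUj⟩ := (hUirr i).isPreirreducible A (U j) hA (hUo j) ⟨a, hi, ha⟩
      ⟨w₀, hw₀U i, hw₀U j⟩
    -- inside the irreducible `U j`, the opens `A` and `B` are both non-empty
    obtain ⟨e, heUj, heA, heB⟩ := (hUirr j).isPreirreducible A B hA hB ⟨c, hcUj, hcA⟩ ⟨b, hj, hb⟩
    exact ⟨e, heA, heB⟩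
  exact ⟨⟨w₀⟩⟩

end Smooth

end Literature.AlgebraicGeometry.Motives.UniversalHypersurface

end
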